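import Mathlib
import HarnessLib
import Summits.ValiantsHypothesis.ValiantsHypothesis.Theorems.KPlusLogSqLawMixedGaugeUpwardLaw
import Summits.ValiantsHypothesis.ValiantsHypothesis.Theorems.KPlusLogSqLawMixedGaugeLoewnerDownward

/-!
# Route «KPlusLogSqLaw», `WeakLifting` (stmt-ValiantsHypothesis-19561) — mixed-gauge series: THE TWO-CLASS LAW AT EVERY INTEGER
# RATIO `r ≥ 2`: `ζ ≤ n + (⌊r/2⌋ + 1)·m` for `[[A + X^a·1, B], [Bᵀ, C − X^{r a}·1]]`

HONEST FRAMING.  Helper file (hand leafhand-val-kpluslogsqlaw-1 g14, 2026-08-31; `--supports stmt-ValiantsHypothesis-19561 --as helper`,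
zero crux / stub credit), sequel of `…MixedGaugeLoewnerDownward` in val-sym-lift-p4 g26's MIXED-GAUGE series.  Object: the two-class
mixed vertex gauge `M(x) = [[A + x^a·1ₙ, B], [Bᵀ, C − x^{ra}·1ₘ]]` (`A ∈ Sym(n)`, `C ∈ Sym(m)`, `B` any real `n × m`, `1 ≤ a`, `2 ≤ r`):
`n` slow POSITIVE diagonal monomials, `m` fast NEGATIVE ones at `r` times the speed, one constant symmetric letter.  The tree has the
law `ζ ≤ n + 2m` at the ratios `3` (`…CubeLoewnerKernel`) and `3 : 2` (`…TwoThirdsLoewnerKernel`); the located law (memo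
MIXED-GAUGE-LAW.md of that seat) is `n + 2m` at every ratio tried.  THIS FILE, for EVERY integer ratio `r ≥ 2`:
* `down_card_le_blocks_pow` — at most `m` DOWNWARD zeros (`‖w‖² ≤ r s^{r−1}‖q‖²`, `s = x^a`): the exponent-`1/r` instance of the
  abstract downward law `MixedGauge.down_card_le_blocks_rpow` (strict Loewner positivity of `y ↦ y^{1/r}`);
* `up_card_le_blocks_pow` — at most `n + ⌊r/2⌋·m` UPWARD zeros: a dependency among the `n + ⌊r/2⌋m + 1` vectors
  `(wⱼ; sⱼ^e qⱼ, e < ⌊r/2⌋)` kills, in the expansion of `0 = ‖Σ dⱼwⱼ‖²` through the two-point identities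
  `⟪wⱼ,wₖ⟫ = (Σ_{i<r} sⱼ^i sₖ^{r−1−i})·⟪qⱼ,qₖ⟫` (`j ≠ k`), every cross moment `⟪Q_i, Q_{r−1−i}⟫` (`Q_i = Σ dⱼsⱼ^i qⱼ`) except the
  middle square `‖Q_{(r−1)/2}‖² ≥ 0` (odd `r`), leaving the positive diagonal — the `r = 3` case is the tree's `up_card_le_blocks`
  (one moment);
* `card_posZeros_le_blocks_pow`, `card_posRoots_det_blockPencil_le_pow` — **`ζ ≤ n + (⌊r/2⌋ + 1)·m`** distinct positive roots of
  `det M(x)`.  At `r = 3` this is the tree's `n + 2m`; at `r = 4, 5` it is `n + 3m` against Descartes' `≈ n + 4m`, `n + 5m` (for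
  `n ≥ r − 1` the exponents `a(i + rj)`, `i ≤ n`, `j ≤ m` fill `[0, n + rm]`); in general `(⌈r/2⌉ − 1)·m` below Descartes and
  `(⌊r/2⌋ − 1)·m` ABOVE the located `n + 2m` — a WEAKER law than located for `r ≥ 4`, said up front.  Nothing here is about
  `WeakLifting` / `TropicalB` in their windows, the registered stubs of `tower_graft.lean`, the doors, `MatrixDescartes` (18050) or
  VP ≠ VNP.  No `def`; axioms standard.  [folklore linear algebra over the Loewner kernel]
-/

set_option linter.dupNamespace false
set_option autoImplicit false

namespace Summit.ValiantsHypothesis.ValiantsHypothesis.Theorems.KPlusLogSqLaw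

namespace MixedGauge

open Matrix Finset
open scoped BigOperators

variable {n m : ℕ}

/-! ## 1. The downward law at integer ratio `r` (instance `p = 1/r` of the abstract law) -/

/-- **Downward law at ratio `r ≥ 2`.**  `m + 1` pairwise distinct positive `sⱼ` with non-zero data `(wⱼ, qⱼ)`, the identities
`(sₖ − sⱼ)⟪wⱼ,wₖ⟫ = (sₖ^r − sⱼ^r)⟪qⱼ,qₖ⟫` and all DOWNWARD (`‖wⱼ‖² ≤ r sⱼ^{r−1} ‖qⱼ‖²`) cannot exist. [folklore] -/
theorem down_card_le_blocks_pow (r : ℕ) (hr : 2 ≤ r) (s : Fin (m + 1) → ℝ) (hs : ∀ j, 0 < s j)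
    (hinj : Function.Injective s) (w : Fin (m + 1) → (Fin n → ℝ)) (q : Fin (m + 1) → (Fin m → ℝ))
    (hnz : ∀ j, w j ≠ 0 ∨ q j ≠ 0)
    (hid : ∀ j k, j ≠ k → (s k - s j) * (w j ⬝ᵥ w k) = (s k ^ r - s j ^ r) * (q j ⬝ᵥ q k))
    (hdown : ∀ j, w j ⬝ᵥ w j ≤ r * s j ^ (r - 1) * (q j ⬝ᵥ q j)) : False := by
  have hr0 : r ≠ 0 := by omega
  have hrpos : (0 : ℝ) < r := by exact_mod_cast (show 0 < r by omega)
  set p : ℝ := ((1 : ℕ) : ℝ) / r with hpdef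
  have hrne : (r : ℝ) ≠ 0 := ne_of_gt hrpos
  have hp : p ∈ Set.Ioo (0 : ℝ) 1 := by
    refine ⟨by rw [hpdef, Nat.cast_one]; exact div_pos one_pos hrpos, ?_⟩
    rw [hpdef, div_lt_one hrpos, Nat.cast_one]
    exact_mod_cast (show 1 < r by omega)
  -- nodes Y = s^r, Y^p = s, p Y^(p-1) = (1/r)·s/s^r
  have hYp : ∀ j, (s j ^ r) ^ p = s j := by
    intro j
    rw [hpdef, TowerGraft.TwoSidedThree.Loewner.pow_rpow_div_natCast (hs j) 1 r hr0, pow_one]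
  have hYp1 : ∀ j, p * (s j ^ r) ^ (p - 1) = (r * s j ^ (r - 1))⁻¹ := by
    intro j
    rw [hpdef, TowerGraft.TwoSidedThree.Loewner.pow_rpow_div_natCast_sub_one (hs j) 1 r hr0, pow_one, Nat.cast_one]
    have hsj : s j ≠ 0 := ne_of_gt (hs j)
    have hsr : s j ^ r = s j * s j ^ (r - 1) := by
      rw [← pow_succ']; congr 1; omega
    rw [hsr, div_mul_eq_div_div, div_self hsj, one_div_mul_one_div, one_div]
  refine down_card_le_blocks_rpow (n := n) (m := m) p hp (fun j => s j ^ r) (fun j => pow_pos (hs j) r) ?_ w q hnz ?_ ?_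
  · intro j k h
    exact hinj ((pow_left_inj₀ (hs j).le (hs k).le hr0).mp h)
  · intro j k hjk
    simp only [hYp]
    exact hid j k hjk
  · intro j
    simp only [hYp1]
    have hpos : 0 < (r : ℝ) * s j ^ (r - 1) := by have := hs j; positivity
    rw [inv_mul_le_iff₀ hpos]
    exact hdown j

/-! ## 2. The upward law at ratio `r`: at most `n + ⌊r/2⌋·m` upward zeros -/

/-- **Upward law, ratio `r`, any number of fast modes.**  `n + ⌊r/2⌋m + 1` pairwise distinct `sⱼ`, vectors `wⱼ ∈ ℝⁿ`, `qⱼ ∈ ℝᵐ`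
with `(sₖ − sⱼ)·⟪wⱼ,wₖ⟫ = (sₖ^r − sⱼ^r)·⟪qⱼ,qₖ⟫` pairwise and all UPWARD (`r sⱼ^{r−1} ‖qⱼ‖² < ‖wⱼ‖²`) cannot exist. [folklore] -/
theorem up_card_le_blocks_pow (r : ℕ) (s : Fin (n + r / 2 * m + 1) → ℝ) (hinj : Function.Injective s)
    (w : Fin (n + r / 2 * m + 1) → (Fin n → ℝ)) (q : Fin (n + r / 2 * m + 1) → (Fin m → ℝ))
    (hid : ∀ j k, j ≠ k → (s k - s j) * (w j ⬝ᵥ w k) = (s k ^ r - s j ^ r) * (q j ⬝ᵥ q k))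
    (hup : ∀ j, r * s j ^ (r - 1) * (q j ⬝ᵥ q j) < w j ⬝ᵥ w j) : False := by
  classical
  -- dependency among the vectors (wⱼ ; sⱼ^e qⱼ (e < ⌊r/2⌋)) in ℝⁿ × ℝ^{⌊r/2⌋ × m}
  let f : (Fin (n + r / 2 * m + 1) → ℝ) →ₗ[ℝ] ((Fin n → ℝ) × (Fin (r / 2) × Fin m → ℝ)) :=
    { toFun := fun d => (∑ j, d j • w j, fun ei => ∑ j, d j * s j ^ (ei.1 : ℕ) * q j ei.2)
      map_add' := by
        intro d d'
        refine Prod.ext ?_ ?_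
        · simp only [Pi.add_apply, add_smul, Finset.sum_add_distrib, Prod.fst_add]
        · funext ei
          simp only [Pi.add_apply, add_mul, Finset.sum_add_distrib, Prod.snd_add]
      map_smul' := by
        intro c d
        refine Prod.ext ?_ ?_
        · simp only [Pi.smul_apply, smul_eq_mul, mul_smul, ← Finset.smul_sum, RingHom.id_apply, Prod.smul_fst]
        · funext ei
          simp only [Pi.smul_apply, smul_eq_mul, RingHom.id_apply, Prod.smul_snd, Finset.mul_sum]
          refine Finset.sum_congr rfl fun j _ => ?_
          ring }
  have hker : LinearMap.ker f ≠ ⊥ := by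
    apply LinearMap.ker_ne_bot_of_finrank_lt
    rw [Module.finrank_prod, Module.finrank_fintype_fun_eq_card, Module.finrank_fintype_fun_eq_card,
      Module.finrank_fintype_fun_eq_card, Fintype.card_fin, Fintype.card_fin, Fintype.card_prod, Fintype.card_fin,
      Fintype.card_fin]
    omega
  obtain ⟨d, hdker, hd0⟩ := (Submodule.ne_bot_iff _).mp hker
  have hfd : f d = 0 := LinearMap.mem_ker.mp hdker
  have hsumw : ∑ j, d j • w j = 0 := (Prod.mk_eq_zero.mp hfd).1
  have hmom : ∀ e : Fin (r / 2), ∀ i : Fin m, ∑ j, d j * s j ^ (e : ℕ) * q j i = 0 := by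
    intro e i
    have := congrFun (Prod.mk_eq_zero.mp hfd).2 (e, i)
    simpa using this
  -- the moments Q_e = Σ dⱼ sⱼ^e qⱼ
  set Q : ℕ → (Fin m → ℝ) := fun e => ∑ j, (d j * s j ^ e) • q j with hQdef
  have hQzero : ∀ e : ℕ, e < r / 2 → Q e = 0 := by
    intro e he
    funext i
    simp only [hQdef, Finset.sum_apply, Pi.smul_apply, smul_eq_mul, Pi.zero_apply]
    have := hmom ⟨e, he⟩ i
    simpa [mul_assoc] using this
  -- the polynomial kernel g j k = Σ_{i<r} sⱼ^i sₖ^{r-1-i}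
  set g : Fin (n + r / 2 * m + 1) → Fin (n + r / 2 * m + 1) → ℝ :=
    fun j k => ∑ i ∈ range r, s j ^ i * s k ^ (r - 1 - i) with hgdef
  have hgdiag : ∀ j, g j j = r * s j ^ (r - 1) := by
    intro j
    simp only [hgdef]
    exact geom_sum₂_self (s j) r
  have hG : ∀ j k, w j ⬝ᵥ w k =
      g j k * (q j ⬝ᵥ q k) + (if j = k then w j ⬝ᵥ w j - r * s j ^ (r - 1) * (q j ⬝ᵥ q j) else 0) := by
    intro j k
    by_cases hjk : j = k
    · subst hjk
      rw [if_pos rfl, hgdiag]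
      ring
    · rw [if_neg hjk, add_zero]
      have hne : s j - s k ≠ 0 := sub_ne_zero.mpr (fun e => hjk (hinj e))
      have hgeom : g j k * (s j - s k) = s j ^ r - s k ^ r := by
        simp only [hgdef]
        exact (Commute.all (s j) (s k)).geom_sum₂_mul r
      have h1 := hid j k hjk
      have h2 : (s j - s k) * (w j ⬝ᵥ w k) = (s j - s k) * (g j k * (q j ⬝ᵥ q k)) := by
        have : (s j - s k) * (w j ⬝ᵥ w k) = (s j ^ r - s k ^ r) * (q j ⬝ᵥ q k) := by linear_combination -h1
        rw [this, ← hgeom]; ring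
      exact mul_left_cancel₀ hne h2
  have hzero : (∑ j, d j • w j) ⬝ᵥ (∑ k, d k • w k) = 0 := by rw [hsumw, dotProduct_zero]
  have hexp : (∑ j, d j • w j) ⬝ᵥ (∑ k, d k • w k) = ∑ j, ∑ k, d j * d k * (w j ⬝ᵥ w k) := by
    rw [sum_dotProduct]
    refine Finset.sum_congr rfl fun j _ => ?_
    rw [dotProduct_sum]
    refine Finset.sum_congr rfl fun k _ => ?_
    rw [smul_dotProduct, dotProduct_smul, smul_eq_mul, smul_eq_mul]
    ring
  have hterm : ∀ j k, d j * d k * (w j ⬝ᵥ w k) =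
      d j * d k * g j k * (q j ⬝ᵥ q k)
        + (if j = k then d j ^ 2 * (w j ⬝ᵥ w j - r * s j ^ (r - 1) * (q j ⬝ᵥ q j)) else 0) := by
    intro j k
    rw [hG j k]
    by_cases hjk : j = k
    · subst hjk; simp only [if_pos]; ring
    · simp only [if_neg hjk]; ring
  have hdouble : ∑ j, ∑ k, d j * d k * (w j ⬝ᵥ w k) =
      (∑ j, ∑ k, d j * d k * g j k * (q j ⬝ᵥ q k))
        + ∑ j, d j ^ 2 * (w j ⬝ᵥ w j - r * s j ^ (r - 1) * (q j ⬝ᵥ q j)) := by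
    simp_rw [hterm, Finset.sum_add_distrib, Finset.sum_ite_eq, Finset.mem_univ, if_true]
  -- the kernel block is the sum of the cross moments ⟪Q_i, Q_{r-1-i}⟫
  have hmoment : ∑ j, ∑ k, d j * d k * g j k * (q j ⬝ᵥ q k) = ∑ i ∈ range r, Q i ⬝ᵥ Q (r - 1 - i) := by
    have hrhs : ∀ i, Q i ⬝ᵥ Q (r - 1 - i) = ∑ j, ∑ k, (d j * s j ^ i) * (d k * s k ^ (r - 1 - i)) * (q j ⬝ᵥ q k) := by
      intro i
      simp only [hQdef]
      rw [sum_dotProduct]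
      refine Finset.sum_congr rfl fun j _ => ?_
      rw [dotProduct_sum]
      refine Finset.sum_congr rfl fun k _ => ?_
      rw [smul_dotProduct, dotProduct_smul, smul_eq_mul, smul_eq_mul]
      ring
    simp_rw [hrhs]
    rw [eq_comm, Finset.sum_comm]
    refine Finset.sum_congr rfl fun j _ => ?_
    rw [Finset.sum_comm]
    refine Finset.sum_congr rfl fun k _ => ?_
    have hg : d j * d k * g j k * (q j ⬝ᵥ q k)
        = ∑ i ∈ range r, d j * s j ^ i * (d k * s k ^ (r - 1 - i)) * (q j ⬝ᵥ q k) := by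
      simp only [hgdef, Finset.mul_sum, Finset.sum_mul]
      refine Finset.sum_congr rfl fun i _ => ?_
      ring
    rw [hg]
  have hmoment_nonneg : 0 ≤ ∑ i ∈ range r, Q i ⬝ᵥ Q (r - 1 - i) := by
    refine Finset.sum_nonneg fun i hi => ?_
    rw [Finset.mem_range] at hi
    by_cases h1 : i < r / 2
    · rw [hQzero i h1, zero_dotProduct]
    · by_cases h2 : r - 1 - i < r / 2
      · rw [hQzero (r - 1 - i) h2, dotProduct_zero]
      · have heq : r - 1 - i = i := by omega
        rw [heq, dotProduct]
        exact Finset.sum_nonneg fun l _ => mul_self_nonneg _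
  have hdiag : 0 < ∑ j, d j ^ 2 * (w j ⬝ᵥ w j - r * s j ^ (r - 1) * (q j ⬝ᵥ q j)) := by
    obtain ⟨j0, hj0⟩ : ∃ j, d j ≠ 0 := by
      by_contra hh
      push Not at hh
      exact hd0 (funext hh)
    apply Finset.sum_pos'
    · intro j _
      exact mul_nonneg (sq_nonneg _) (by linarith [hup j])
    · exact ⟨j0, Finset.mem_univ _, mul_pos (by positivity) (by linarith [hup j0])⟩
  rw [hexp, hdouble, hmoment] at hzero
  linarith

/-! ## 3. The count `ζ ≤ n + (⌊r/2⌋ + 1)·m` -/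

/-- **TWO-CLASS LAW at ratio `r ≥ 2`.**  `A ∈ Sym(n)`, `C ∈ Sym(m)`, `B` any real `n × m` matrix, `1 ≤ a`: a finite set `S` of positive
`x`, each carrying a non-zero kernel vector `(w, q)` of `[[A + x^a·1, B], [Bᵀ, C − x^{ra}·1]]`, has `#S ≤ n + (⌊r/2⌋ + 1)·m`
(`≤ m` downward by §1, `≤ n + ⌊r/2⌋m` upward by §2). -/
theorem card_posZeros_le_blocks_pow (r : ℕ) (hr : 2 ≤ r)
    (A : Matrix (Fin n) (Fin n) ℝ) (hA : A.IsSymm) (C : Matrix (Fin m) (Fin m) ℝ) (hC : C.IsSymm)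
    (B : Matrix (Fin n) (Fin m) ℝ) (a : ℕ) (ha : 1 ≤ a) (S : Finset ℝ)
    (hS : ∀ x ∈ S, 0 < x ∧ ∃ w : Fin n → ℝ, ∃ q : Fin m → ℝ, (w ≠ 0 ∨ q ≠ 0) ∧
      (A + (x ^ a) • (1 : Matrix (Fin n) (Fin n) ℝ)) *ᵥ w + B *ᵥ q = 0 ∧
      Bᵀ *ᵥ w + (C - (x ^ (r * a)) • (1 : Matrix (Fin m) (Fin m) ℝ)) *ᵥ q = 0) :
    S.card ≤ n + (r / 2 + 1) * m := by
  classical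
  have hx : ∀ x : S, 0 < (x : ℝ) := fun x => (hS x x.2).1
  choose W Q hWQ using fun x : S => (hS x x.2).2
  have hpowr : ∀ x : ℝ, x ^ (r * a) = (x ^ a) ^ r := fun x => by rw [mul_comm, pow_mul]
  have hsinj : ∀ x y : S, (x : ℝ) ^ a = (y : ℝ) ^ a → x = y := by
    intro x y hxy
    have ha0 : a ≠ 0 := by omega
    exact Subtype.ext ((pow_left_inj₀ (hx x).le (hx y).le ha0).mp hxy)
  have hid : ∀ x y : S, ((y : ℝ) ^ a - (x : ℝ) ^ a) * (W x ⬝ᵥ W y) =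
      (((y : ℝ) ^ a) ^ r - ((x : ℝ) ^ a) ^ r) * (Q x ⬝ᵥ Q y) := by
    intro x y
    have hh := two_point_blocks A hA C hC B ((x : ℝ) ^ a) ((x : ℝ) ^ (r * a)) ((y : ℝ) ^ a) ((y : ℝ) ^ (r * a))
      (W x) (W y) (Q x) (Q y) (hWQ x).2.1 (hWQ x).2.2 (hWQ y).2.1 (hWQ y).2.2
    rw [hpowr, hpowr] at hh
    exact hh
  let down : ℝ → Prop := fun x => if hxS : x ∈ S then
    W ⟨x, hxS⟩ ⬝ᵥ W ⟨x, hxS⟩ ≤ r * (x ^ a) ^ (r - 1) * (Q ⟨x, hxS⟩ ⬝ᵥ Q ⟨x, hxS⟩) else False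
  have hsplit := Finset.card_filter_add_card_filter_not (s := S) down
  -- downward zeros: at most m
  have hdown : (S.filter down).card ≤ m := by
    by_contra hlt
    push Not at hlt
    obtain ⟨T, hTsub, hTcard⟩ := Finset.exists_subset_card_eq (show m + 1 ≤ (S.filter down).card by omega)
    have hTS : ∀ x ∈ T, x ∈ S := fun x hxT => (Finset.mem_filter.mp (hTsub hxT)).1
    have hTdown : ∀ x (hxT : x ∈ T), W ⟨x, hTS x hxT⟩ ⬝ᵥ W ⟨x, hTS x hxT⟩ ≤
        r * (x ^ a) ^ (r - 1) * (Q ⟨x, hTS x hxT⟩ ⬝ᵥ Q ⟨x, hTS x hxT⟩) := by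
      intro x hxT
      have hh := (Finset.mem_filter.mp (hTsub hxT)).2
      simp only [down, dif_pos (hTS x hxT)] at hh
      exact hh
    let e : Fin (m + 1) ≃ T := (T.equivFinOfCardEq hTcard).symm
    let emb : Fin (m + 1) → S := fun j => ⟨(e j : ℝ), hTS _ (e j).2⟩
    have hembinj : Function.Injective emb := by
      intro j k hjk
      have h' : ((emb j : S) : ℝ) = ((emb k : S) : ℝ) := congrArg Subtype.val hjk
      exact e.injective (Subtype.ext h')
    refine down_card_le_blocks_pow (n := n) (m := m) r hr (fun j => ((emb j : S) : ℝ) ^ a)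
      (fun j => pow_pos (hx (emb j)) a) ?_ (fun j => W (emb j)) (fun j => Q (emb j)) (fun j => (hWQ (emb j)).1) ?_ ?_
    · intro j k hjk
      exact hembinj (hsinj _ _ hjk)
    · intro j k _
      exact hid (emb j) (emb k)
    · intro j
      exact hTdown (e j : ℝ) (e j).2
  -- upward zeros: at most n + ⌊r/2⌋·m
  have hupc : (S.filter fun x => ¬ down x).card ≤ n + r / 2 * m := by
    by_contra hlt
    push Not at hlt
    obtain ⟨T, hTsub, hTcard⟩ :=
      Finset.exists_subset_card_eq (show n + r / 2 * m + 1 ≤ (S.filter fun x => ¬ down x).card by omega)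
    have hTS : ∀ x ∈ T, x ∈ S := fun x hxT => (Finset.mem_filter.mp (hTsub hxT)).1
    have hTup : ∀ x (hxT : x ∈ T), r * (x ^ a) ^ (r - 1) * (Q ⟨x, hTS x hxT⟩ ⬝ᵥ Q ⟨x, hTS x hxT⟩) <
        W ⟨x, hTS x hxT⟩ ⬝ᵥ W ⟨x, hTS x hxT⟩ := by
      intro x hxT
      have hh := (Finset.mem_filter.mp (hTsub hxT)).2
      simp only [down, dif_pos (hTS x hxT), not_le] at hh
      exact hh
    let e : Fin (n + r / 2 * m + 1) ≃ T := (T.equivFinOfCardEq hTcard).symm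
    let emb : Fin (n + r / 2 * m + 1) → S := fun j => ⟨(e j : ℝ), hTS _ (e j).2⟩
    have hembinj : Function.Injective emb := by
      intro j k hjk
      have h' : ((emb j : S) : ℝ) = ((emb k : S) : ℝ) := congrArg Subtype.val hjk
      exact e.injective (Subtype.ext h')
    refine up_card_le_blocks_pow (n := n) (m := m) r (fun j => ((emb j : S) : ℝ) ^ a) ?_
      (fun j => W (emb j)) (fun j => Q (emb j)) ?_ ?_
    · intro j k hjk
      exact hembinj (hsinj _ _ hjk)
    · intro j k _
      exact hid (emb j) (emb k)
    · intro j
      exact hTup (e j : ℝ) (e j).2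
  have hsplit' : (S.filter down).card + (S.filter fun x => ¬ down x).card = S.card := hsplit
  calc S.card = (S.filter down).card + (S.filter fun x => ¬ down x).card := hsplit'.symm
    _ ≤ m + (n + r / 2 * m) := Nat.add_le_add hdown hupc
    _ = n + (r / 2 + 1) * m := by ring

/-! ## 4. Determinant currency -/

/-- evaluation of the block pencil `[[A + X^a·1, B], [Bᵀ, C − X^b·1]]` at a real point. [folklore] -/
theorem eval_blockPencil_pow (A : Matrix (Fin n) (Fin n) ℝ) (C : Matrix (Fin m) (Fin m) ℝ) (B : Matrix (Fin n) (Fin m) ℝ)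
    (a b : ℕ) (x : ℝ) :
    (Polynomial.evalRingHom x).mapMatrix
        (Matrix.fromBlocks (A.map Polynomial.C + ((Polynomial.X : Polynomial ℝ) ^ a) • 1) (B.map Polynomial.C)
          (Bᵀ.map Polynomial.C) (C.map Polynomial.C - ((Polynomial.X : Polynomial ℝ) ^ b) • 1)) =
      Matrix.fromBlocks (A + (x ^ a) • (1 : Matrix (Fin n) (Fin n) ℝ)) B Bᵀ
        (C - (x ^ b) • (1 : Matrix (Fin m) (Fin m) ℝ)) := by
  rw [RingHom.mapMatrix_apply, Matrix.fromBlocks_map]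
  congr 1
  · ext i j
    by_cases hij : i = j
    · subst hij; simp
    · simp [Matrix.one_apply_ne hij]
  · ext i j
    simp
  · ext i j
    simp
  · ext i j
    by_cases hij : i = j
    · subst hij; simp
    · simp [Matrix.one_apply_ne hij]

/-- **TWO-CLASS LAW at every integer ratio `r ≥ 2`, determinant currency.**  For `A ∈ Sym(n)`, `C ∈ Sym(m)`, any real `B`, `1 ≤ a`:
the determinant of the block lacunary pencil `[[A + X^a·1, B], [Bᵀ, C − X^{ra}·1]]` (`n` slow positive diagonal monomials, `m` fast
negative ones at `r` times the speed, one constant symmetric letter) has at most `n + (⌊r/2⌋ + 1)·m` distinct positive real roots. -/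
theorem card_posRoots_det_blockPencil_le_pow (r : ℕ) (hr : 2 ≤ r)
    (A : Matrix (Fin n) (Fin n) ℝ) (hA : A.IsSymm) (C : Matrix (Fin m) (Fin m) ℝ)
    (hC : C.IsSymm) (B : Matrix (Fin n) (Fin m) ℝ) (a : ℕ) (ha : 1 ≤ a) :
    ((Matrix.det (Matrix.fromBlocks (A.map Polynomial.C + ((Polynomial.X : Polynomial ℝ) ^ a) • 1) (B.map Polynomial.C)
          (Bᵀ.map Polynomial.C)
          (C.map Polynomial.C - ((Polynomial.X : Polynomial ℝ) ^ (r * a)) • 1))).roots.toFinset.filter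
        (fun x => 0 < x)).card ≤ n + (r / 2 + 1) * m := by
  classical
  refine card_posZeros_le_blocks_pow r hr A hA C hC B a ha _ ?_
  intro x hxm
  rw [Finset.mem_filter, Multiset.mem_toFinset, Polynomial.mem_roots'] at hxm
  obtain ⟨⟨_, hroot⟩, hxpos⟩ := hxm
  refine ⟨hxpos, ?_⟩
  have hdet : (Matrix.fromBlocks (A + (x ^ a) • (1 : Matrix (Fin n) (Fin n) ℝ)) B Bᵀ
      (C - (x ^ (r * a)) • (1 : Matrix (Fin m) (Fin m) ℝ))).det = 0 := by
    rw [← eval_blockPencil_pow, ← RingHom.map_det]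
    exact hroot
  obtain ⟨u, hu0, hu⟩ := Matrix.exists_mulVec_eq_zero_iff.mpr hdet
  rw [Matrix.fromBlocks_mulVec] at hu
  have h1 := congrFun hu
  refine ⟨u ∘ Sum.inl, u ∘ Sum.inr, ?_, ?_, ?_⟩
  · by_contra hboth
    push Not at hboth
    apply hu0
    funext i
    rcases i with i | i
    · exact congrFun hboth.1 i
    · exact congrFun hboth.2 i
  · funext i
    have hi := h1 (Sum.inl i)
    simpa only [Sum.elim_inl, Pi.add_apply, Pi.zero_apply] using hi
  · funext i
    have hi := h1 (Sum.inr i)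
    simpa only [Sum.elim_inr, Pi.add_apply, Pi.zero_apply] using hi

/-- **Ratio 4 and 5 read off**: `ζ ≤ n + 3m` for `[[A + X^a·1, B], [Bᵀ, C − X^{4a}·1]]` (Descartes: about `n + 4m`). -/
theorem card_posRoots_det_blockPencil_le_ratioFour
    (A : Matrix (Fin n) (Fin n) ℝ) (hA : A.IsSymm) (C : Matrix (Fin m) (Fin m) ℝ)
    (hC : C.IsSymm) (B : Matrix (Fin n) (Fin m) ℝ) (a : ℕ) (ha : 1 ≤ a) :
    ((Matrix.det (Matrix.fromBlocks (A.map Polynomial.C + ((Polynomial.X : Polynomial ℝ) ^ a) • 1) (B.map Polynomial.C)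
          (Bᵀ.map Polynomial.C)
          (C.map Polynomial.C - ((Polynomial.X : Polynomial ℝ) ^ (4 * a)) • 1))).roots.toFinset.filter
        (fun x => 0 < x)).card ≤ n + 3 * m := by
  have hh := card_posRoots_det_blockPencil_le_pow (n := n) (m := m) 4 (by norm_num) A hA C hC B a ha
  simpa using hh

end MixedGauge

end Summit.ValiantsHypothesis.ValiantsHypothesis.Theorems.KPlusLogSqLaw
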